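import Mathlib
import HarnessLib

/-!
# Format C, L-C1 (prime part): the shifted-window exponential integral behind Yoshida (5.15)/(5.16)

Route context: Fourier–Galerkin / Schur-complement certificates of Weil positivity on a window ("format C";
cell memo `run/shared/lean/pub/rh-explicit/rh-explicit-weil-10/FORMATC-DESIGN.md` §1 (c1), §8.9 (1)(b); supporting
stmt-RiemannHypothesis-0098).  The prime part of Weil's functional on `f ⋆ f̃` with `f` supported in `[−a, a]` is
`−Σ_ℓ Λ_ℓ · 2 Re ⟨f(· − ℓ), f⟩`, `ℓ = e·log p < 2a`.  In the window's Fourier basis `χ_n = (2a)^{−1/2} e^{iω_n x} 1_{[−a,a]}`,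
`ω_n = πn/a`, the matrix entries are the integrals
`∫_{−a+ℓ}^{a} e^{iω_m(x−ℓ)} e^{−iω_n x} dx` — the support of `χ_m(· − ℓ)·χ̄_n` is `[−a+ℓ, a]`.  THIS FILE evaluates them:

* `WeilFormatC.integral_cexp_shift_window_self` — `n = m`: `(2a − ℓ)·e^{−iω_n ℓ}`;
* `WeilFormatC.integral_cexp_shift_window` — `n ≠ m`: `(−1)^{m−n}·(e^{−iω_m ℓ} − e^{−iω_n ℓ})/(i(ω_m − ω_n))`
  (uses `e^{iπ(m−n)} = (−1)^{m−n}`);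
* `WeilFormatC.re_shift_window_offDiag` — the real part of the bracket: `Re[(e^{−iω_mℓ} − e^{−iω_nℓ})/(i(ω_m − ω_n))]
  = (sin(ω_n ℓ) − sin(ω_m ℓ))/(ω_m − ω_n)`, i.e. with `ω_m − ω_n = π(m−n)/a` Yoshida's
  `Prime(n,m) = −Σ_ℓ Λ_ℓ (−1)^{n−m}(sin ω_mℓ − sin ω_nℓ)/(π(n−m))` and `Prime(n,n) = −Σ_ℓ 2Λ_ℓ(1 − ℓ/2a)cos ω_nℓ`
  after the `1/(2a)` normalisation and `S_ℓ + S_ℓ*` [Yoshida 1992, (5.15)–(5.16)].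

Pure calculus (`integral_exp_mul_complex`); standard axioms only.  NOT here: the window basis as a definition and
the identification with `weilPrimeTerm` (L-C1 assembly).
-/

-- `Summit.RiemannHypothesis.RiemannHypothesis.…` is the layout-mandated namespace (summit = problem name).
set_option linter.dupNamespace false

noncomputable section

open Complex MeasureTheory intervalIntegral
open scoped Real

namespace Summit.RiemannHypothesis.RiemannHypothesis.Theorems.WeilFormatC

/-- `e^{iπk} = (−1)^k` for integer `k`. -/
theorem cexp_int_mul_pi_mul_I (k : ℤ) : cexp ((k : ℂ) * (π * I)) = (-1 : ℂ) ^ k := by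
  rw [Complex.exp_int_mul, Complex.exp_pi_mul_I]

/-- Diagonal case: `∫_{−a+ℓ}^{a} e^{i(ω(x−ℓ) − ωx)} dx = (2a − ℓ)·e^{−iωℓ}`. -/
theorem integral_cexp_shift_window_self (a ℓ ω : ℝ) :
    ∫ x in (-a + ℓ)..a, cexp (I * ((ω : ℂ) * ((x : ℂ) - ℓ) - ω * x))
      = ((2 * a - ℓ : ℝ) : ℂ) * cexp (-(I * ω * ℓ)) := by
  have e : ∀ x : ℝ, cexp (I * ((ω : ℂ) * ((x : ℂ) - ℓ) - ω * x)) = cexp (-(I * ω * ℓ)) := by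
    intro x; congr 1; ring
  simp_rw [e]
  rw [intervalIntegral.integral_const]
  push_cast
  simp
  ring

/-- Off-diagonal case: for integers `n ≠ m`, `ω_k = πk/a` (`a ≠ 0`),
`∫_{−a+ℓ}^{a} e^{i(ω_m(x−ℓ) − ω_n x)} dx = (−1)^{m−n}·(e^{−iω_mℓ} − e^{−iω_nℓ})/(i(ω_m − ω_n))`. -/
theorem integral_cexp_shift_window {a : ℝ} (ha : a ≠ 0) (ℓ : ℝ) {n m : ℤ} (hnm : n ≠ m) :
    ∫ x in (-a + ℓ)..a, cexp (I * (((π * m / a : ℝ) : ℂ) * ((x : ℂ) - ℓ) - ((π * n / a : ℝ) : ℂ) * x))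
      = (-1 : ℂ) ^ (m - n) * (cexp (-(I * ((π * m / a : ℝ) : ℂ) * ℓ)) - cexp (-(I * ((π * n / a : ℝ) : ℂ) * ℓ)))
        / (I * ((((π * m / a : ℝ) : ℂ)) - ((π * n / a : ℝ) : ℂ))) := by
  set wm : ℝ := π * m / a with hwm
  set wn : ℝ := π * n / a with hwn
  have hΔ : wm - wn ≠ 0 := by
    have hmn : (m : ℝ) - n ≠ 0 := sub_ne_zero.mpr (by exact_mod_cast (Ne.symm hnm))
    have e : wm - wn = π * ((m : ℝ) - n) / a := by rw [hwm, hwn]; ring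
    rw [e]
    exact div_ne_zero (mul_ne_zero Real.pi_ne_zero hmn) ha
  have hac : (a : ℂ) ≠ 0 := ofReal_ne_zero.mpr ha
  set c : ℂ := I * (((wm : ℝ) : ℂ) - ((wn : ℝ) : ℂ)) with hc
  have hc0 : c ≠ 0 := by
    rw [hc]; refine mul_ne_zero I_ne_zero ?_
    rw [← ofReal_sub]; exact ofReal_ne_zero.mpr hΔ
  -- factor the integrand: e^{-i wm ℓ} · e^{c x}
  have e : ∀ x : ℝ, cexp (I * (((wm : ℝ) : ℂ) * ((x : ℂ) - ℓ) - ((wn : ℝ) : ℂ) * x))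
      = cexp (-(I * wm * ℓ)) * cexp (c * x) := by
    intro x; rw [← Complex.exp_add]; congr 1; rw [hc]; ring
  simp_rw [e]
  rw [intervalIntegral.integral_const_mul, integral_exp_mul_complex hc0]
  -- endpoint values: c·a = iπ(m-n), c·(-a+ℓ) = -iπ(m-n) + c ℓ
  have hca : c * (a : ℝ) = ((m - n : ℤ) : ℂ) * (π * I) := by
    rw [hc, hwm, hwn]; push_cast; field_simp
  have hcb : c * ((-a + ℓ : ℝ) : ℂ) = -(((m - n : ℤ) : ℂ) * (π * I)) + c * ℓ := by
    rw [hc, hwm, hwn]; push_cast; field_simp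
  have hpow : cexp (((m - n : ℤ) : ℂ) * (π * I)) = (-1 : ℂ) ^ (m - n) := cexp_int_mul_pi_mul_I _
  have hpow' : cexp (-(((m - n : ℤ) : ℂ) * (π * I))) = (-1 : ℂ) ^ (m - n) := by
    rw [Complex.exp_neg, hpow, ← inv_zpow, inv_neg, inv_one]
  rw [hca, hcb, Complex.exp_add, hpow, hpow']
  have hcl : cexp (-(I * wm * ℓ)) * cexp (c * ℓ) = cexp (-(I * wn * ℓ)) := by
    rw [← Complex.exp_add]; congr 1; rw [hc]; ring
  have h2 : cexp (-(I * (wm : ℂ) * ℓ)) * (((-1 : ℂ) ^ (m - n) - (-1 : ℂ) ^ (m - n) * cexp (c * ℓ)) / c)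
      = (-1 : ℂ) ^ (m - n) * (cexp (-(I * (wm : ℂ) * ℓ)) - cexp (-(I * (wm : ℂ) * ℓ)) * cexp (c * ℓ)) / c := by
    ring
  rw [h2, hcl]

/-- The real part of the off-diagonal bracket: for real `ω_m ≠ ω_n`,
`Re[(e^{−iω_mℓ} − e^{−iω_nℓ})/(i(ω_m − ω_n))] = (sin(ω_nℓ) − sin(ω_mℓ))/(ω_m − ω_n)`. -/
theorem re_shift_window_offDiag {wm wn : ℝ} (h : wm ≠ wn) (ℓ : ℝ) :
    ((cexp (-(I * wm * ℓ)) - cexp (-(I * wn * ℓ))) / (I * ((wm : ℂ) - wn))).re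
      = (Real.sin (wn * ℓ) - Real.sin (wm * ℓ)) / (wm - wn) := by
  have hr : wm - wn ≠ 0 := sub_ne_zero.mpr h
  -- e^{-iθ} = cos θ - i sin θ with REAL cos/sin as opaque atoms
  have hexp : ∀ θ : ℝ, cexp (-(I * θ * ℓ)) = ((Real.cos (θ * ℓ) : ℝ) : ℂ) - ((Real.sin (θ * ℓ) : ℝ) : ℂ) * I := by
    intro θ
    rw [show -(I * (θ : ℂ) * ℓ) = ((-(θ * ℓ) : ℝ) : ℂ) * I by push_cast; ring, Complex.exp_mul_I,
      ← Complex.ofReal_cos, ← Complex.ofReal_sin, Real.cos_neg, Real.sin_neg]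
    push_cast
    ring
  rw [hexp wm, hexp wn]
  set Cm := Real.cos (wm * ℓ)
  set Sm := Real.sin (wm * ℓ)
  set Cn := Real.cos (wn * ℓ)
  set Sn := Real.sin (wn * ℓ)
  have hw : (I * ((wm : ℂ) - wn)) = ((0 : ℝ) : ℂ) + ((wm - wn : ℝ) : ℂ) * I := by push_cast; ring
  have hz : ((Cm : ℂ) - (Sm : ℂ) * I - ((Cn : ℂ) - (Sn : ℂ) * I)) = ((Cm - Cn : ℝ) : ℂ) + ((Sn - Sm : ℝ) : ℂ) * I := by
    push_cast; ring
  rw [hz, hw, Complex.div_re]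
  simp only [Complex.add_re, Complex.ofReal_re, Complex.mul_re, Complex.I_re, Complex.ofReal_im, Complex.I_im,
    Complex.add_im, Complex.mul_im, mul_zero, mul_one, sub_zero, zero_add, add_zero,
    Complex.normSq_apply]
  field_simp
  ring

end Summit.RiemannHypothesis.RiemannHypothesis.Theorems.WeilFormatC
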